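import Summits.KontsevichZagierPeriods.KontsevichZagierPeriods.Theorems.HyperbolicBlochOffTetraSectorKernelDistribution
import Summits.KontsevichZagierPeriods.KontsevichZagierPeriods.Theorems.HyperbolicBlochOffTetraSectorKernelStubDivisibleOfDistribution
import Summits.KontsevichZagierPeriods.KontsevichZagierPeriods.Theorems.BetaCancellation.Negative.Torsion
import Summits.KontsevichZagierPeriods.KontsevichZagierPeriods.Theses.HyperbolicBloch

/-!
# `OffTetraSectorKernel` (stmt-KontsevichZagierPeriods-10557), line `odd-hyperbolic-ladder` v11: the residue quotient is torsion-free

Skeleton v11 of the line (continuation lead c8) composed: the distribution relations of the Bloch–Wigner oracle are moves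
(`stub_distribution`, Theorems/…Distribution.lean), hence every tetrahedral value-relator is divisible modulo relations
(`oracle_divisible`, via `stub_divisibleOfDistribution`), divisibility passes to the closure (`closure_tetra_divisible`),
and since the formal period group `FormalRep ⧸ relations` is torsion-free (integer division is a derived rule,
`BetaCancellationNegative.mem_relations_of_nsmul_mem`) the RESIDUE QUOTIENT `FormalRep ⧸ (relations ⊔ closure tetraRelators)`
of the crux `OffTetraSectorKernel` is TORSION-FREE (`torsionFree_sup_closure_tetra`) — the disprover's last open refutation
door (`Cruxes/OffTetraSectorKernel/Disproof.lean` §6 `not_of_torsion`, conditional there on the crux) closed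
unconditionally. Corollary: the crux is equivalent to its `ℚ`-form (`offTetraSectorKernel_iff_rationalForm`): a certificate
for SOME positive multiple of a kernel element suffices.

References: J. L. Dupont, C.-H. Sah, *Scissors congruences II* (1982), §5 (divisibility of the Bloch group); D. Zagier,
*The dilogarithm function* (2007), Ch. I §2; M. Kontsevich, D. Zagier, *Periods* (2001), §1.2.
-/

noncomputable section

open Set MeasureTheory
open Literature.NumberTheory.Transcendental

namespace Summit.KontsevichZagierPeriods.HyperbolicBloch.OffTetraSectorKernel

/-- **THE BLOCH–WIGNER ORACLE IS DIVISIBLE INSIDE THE CALCULUS** (v11 assembly, from `stub_distribution` and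
`stub_divisibleOfDistribution`): for every `k ≥ 1`, every tetrahedral value-relator `d = Σ nᵢ•[ρ zᵢ]` is congruent modulo
`KZ.relations` to `k • d′` for another tetrahedral value-relator `d′` over the same admissible family — the KZ-shadow of the
divisibility of the Bloch group of `ℚ̄`. [cite: DupontSah1982, §5] -/
theorem oracle_divisible :
    ∀ (T : ℂ → Set (Fin 3 → ℝ)), (∀ z, T z = {p | 0 < p 1 ∧ z.re * p 1 < z.im * p 0 ∧ z.im * (p 0 - 1) < (z.re - 1) * p 1 ∧ 0 < p 2 ∧ 0 < z.im * (p 0 ^ 2 + p 1 ^ 2 + p 2 ^ 2 - p 0) + (z.re - Complex.normSq z) * p 1}) →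
    ∀ (k : ℕ), 1 ≤ k → ∀ d ∈ {d : KZ.FormalRep | ∃ ρ : ℂ → KZ.IntegralRep 3, (∀ z, IsAlgebraic ℚ z → 0 < z.im → (ρ z).domain = T z ∧ Set.EqOn (ρ z).integrand (fun p => 1 / p 2 ^ 3) (T z)) ∧ ∃ (k : ℕ) (z : Fin k → ℂ) (n : Fin k → ℤ), (∀ i, IsAlgebraic ℚ (z i)) ∧ (∀ i, 0 < (z i).im) ∧ ∑ i, (n i : ℝ) * (ρ (z i)).value = 0 ∧ d = ∑ i, n i • KZ.of (ρ (z i))},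
      ∃ d' ∈ {d : KZ.FormalRep | ∃ ρ : ℂ → KZ.IntegralRep 3, (∀ z, IsAlgebraic ℚ z → 0 < z.im → (ρ z).domain = T z ∧ Set.EqOn (ρ z).integrand (fun p => 1 / p 2 ^ 3) (T z)) ∧ ∃ (k : ℕ) (z : Fin k → ℂ) (n : Fin k → ℤ), (∀ i, IsAlgebraic ℚ (z i)) ∧ (∀ i, 0 < (z i).im) ∧ ∑ i, (n i : ℝ) * (ρ (z i)).value = 0 ∧ d = ∑ i, n i • KZ.of (ρ (z i))}, d - k • d' ∈ KZ.relations := by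
  intro T hT k hk d hd
  exact stub_divisibleOfDistribution T (stub_distribution T hT) k hk d hd

/-- Divisibility passes from the generators to the closure of the tetrahedral value-relators. [cite: DupontSah1982, §5] -/
theorem closure_tetra_divisible :
    ∀ (T : ℂ → Set (Fin 3 → ℝ)), (∀ z, T z = {p | 0 < p 1 ∧ z.re * p 1 < z.im * p 0 ∧ z.im * (p 0 - 1) < (z.re - 1) * p 1 ∧ 0 < p 2 ∧ 0 < z.im * (p 0 ^ 2 + p 1 ^ 2 + p 2 ^ 2 - p 0) + (z.re - Complex.normSq z) * p 1}) →
    ∀ (k : ℕ), 1 ≤ k → ∀ x ∈ AddSubgroup.closure {d : KZ.FormalRep | ∃ ρ : ℂ → KZ.IntegralRep 3, (∀ z, IsAlgebraic ℚ z → 0 < z.im → (ρ z).domain = T z ∧ Set.EqOn (ρ z).integrand (fun p => 1 / p 2 ^ 3) (T z)) ∧ ∃ (k : ℕ) (z : Fin k → ℂ) (n : Fin k → ℤ), (∀ i, IsAlgebraic ℚ (z i)) ∧ (∀ i, 0 < (z i).im) ∧ ∑ i, (n i : ℝ) * (ρ (z i)).value = 0 ∧ d = ∑ i, n i • KZ.of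 (ρ (z i))},
      ∃ y ∈ AddSubgroup.closure {d : KZ.FormalRep | ∃ ρ : ℂ → KZ.IntegralRep 3, (∀ z, IsAlgebraic ℚ z → 0 < z.im → (ρ z).domain = T z ∧ Set.EqOn (ρ z).integrand (fun p => 1 / p 2 ^ 3) (T z)) ∧ ∃ (k : ℕ) (z : Fin k → ℂ) (n : Fin k → ℤ), (∀ i, IsAlgebraic ℚ (z i)) ∧ (∀ i, 0 < (z i).im) ∧ ∑ i, (n i : ℝ) * (ρ (z i)).value = 0 ∧ d = ∑ i, n i • KZ.of (ρ (z i))}, x - k • y ∈ KZ.relations := by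
  intro T hT k hk x hx
  induction hx using AddSubgroup.closure_induction with
  | mem d hd =>
    obtain ⟨d', hd', h⟩ := oracle_divisible T hT k hk d hd
    exact ⟨d', AddSubgroup.subset_closure hd', h⟩
  | zero => exact ⟨0, zero_mem _, by rw [smul_zero, sub_zero]; exact zero_mem _⟩
  | add x y _ _ hx hy =>
    obtain ⟨x', hx', hxx⟩ := hx
    obtain ⟨y', hy', hyy⟩ := hy
    refine ⟨x' + y', add_mem hx' hy', ?_⟩
    have : x + y - k • (x' + y') = (x - k • x') + (y - k • y') := by rw [smul_add]; abel
    rw [this]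
    exact add_mem hxx hyy
  | neg x _ hx =>
    obtain ⟨x', hx', hxx⟩ := hx
    refine ⟨-x', neg_mem hx', ?_⟩
    have : -x - k • (-x') = -(x - k • x') := by rw [smul_neg]; abel
    rw [this]
    exact neg_mem hxx

/-- **`FormalRep ⧸ (relations ⊔ closure tetraRelators)` IS TORSION-FREE** (Disproof §6 `not_of_torsion` closed
unconditionally): if a positive multiple of `c` lies in the target subgroup of the crux, so does `c` — the oracle is divisible
modulo relations (`closure_tetra_divisible`) and `FormalRep ⧸ relations` is torsion-free
(`BetaCancellationNegative.mem_relations_of_nsmul_mem`). [cite: DupontSah1982, §5] -/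
theorem torsionFree_sup_closure_tetra :
    ∀ (T : ℂ → Set (Fin 3 → ℝ)), (∀ z, T z = {p | 0 < p 1 ∧ z.re * p 1 < z.im * p 0 ∧ z.im * (p 0 - 1) < (z.re - 1) * p 1 ∧ 0 < p 2 ∧ 0 < z.im * (p 0 ^ 2 + p 1 ^ 2 + p 2 ^ 2 - p 0) + (z.re - Complex.normSq z) * p 1}) →
    ∀ (k : ℕ), k ≠ 0 → ∀ c : KZ.FormalRep,
      k • c ∈ KZ.relations ⊔ AddSubgroup.closure {d : KZ.FormalRep | ∃ ρ : ℂ → KZ.IntegralRep 3, (∀ z, IsAlgebraic ℚ z → 0 < z.im → (ρ z).domain = T z ∧ Set.EqOn (ρ z).integrand (fun p => 1 / p 2 ^ 3) (T z)) ∧ ∃ (k : ℕ) (z : Fin k → ℂ) (n : Fin k → ℤ), (∀ i, IsAlgebraic ℚ (z i)) ∧ (∀ i, 0 < (z i).im) ∧ ∑ i, (n i : ℝ) * (ρ (z i)).value = 0 ∧ d = ∑ i, n i • KZ.of (ρ (z i))} →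
      c ∈ KZ.relations ⊔ AddSubgroup.closure {d : KZ.FormalRep | ∃ ρ : ℂ → KZ.IntegralRep 3, (∀ z, IsAlgebraic ℚ z → 0 < z.im → (ρ z).domain = T z ∧ Set.EqOn (ρ z).integrand (fun p => 1 / p 2 ^ 3) (T z)) ∧ ∃ (k : ℕ) (z : Fin k → ℂ) (n : Fin k → ℤ), (∀ i, IsAlgebraic ℚ (z i)) ∧ (∀ i, 0 < (z i).im) ∧ ∑ i, (n i : ℝ) * (ρ (z i)).value = 0 ∧ d = ∑ i, n i • KZ.of (ρ (z i))} := by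
  intro T hT k hk c hc
  obtain ⟨r, hr, t, ht, hrt⟩ := AddSubgroup.mem_sup.mp hc
  obtain ⟨t', ht', htt⟩ := closure_tetra_divisible T hT k (Nat.one_le_iff_ne_zero.mpr hk) t ht
  have hk' : k • (c - t') ∈ KZ.relations := by
    have : k • (c - t') = r + (t - k • t') := by rw [smul_sub, ← hrt]; abel
    rw [this]
    exact add_mem hr htt
  have hct : c - t' ∈ KZ.relations :=
    Summit.KontsevichZagierPeriods.KontsevichZagierPeriods.BetaCancellationNegative.mem_relations_of_nsmul_mem hk hk'
  have : c = (c - t') + t' := by abel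
  rw [this]
  exact add_mem (AddSubgroup.mem_sup_left hct) (AddSubgroup.mem_sup_right ht')

/-- **The crux is equivalent to its `ℚ`-form** (certificates for a positive multiple suffice).
[cite: KontsevichZagier2001, §1.2] -/
theorem offTetraSectorKernel_iff_rationalForm :
    Summit.KontsevichZagierPeriods.KontsevichZagierPeriods.Theses.HyperbolicBloch.OffTetraSectorKernel ↔
    (∀ (T : ℂ → Set (Fin 3 → ℝ)), (∀ z, T z = {p | 0 < p 1 ∧ z.re * p 1 < z.im * p 0 ∧ z.im * (p 0 - 1) < (z.re - 1) * p 1 ∧ 0 < p 2 ∧ 0 < z.im * (p 0 ^ 2 + p 1 ^ 2 + p 2 ^ 2 - p 0) + (z.re - Complex.normSq z) * p 1}) →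
      ∀ c : KZ.FormalRep, KZ.eval c = 0 → ∃ N : ℕ, N ≠ 0 ∧
        N • c ∈ KZ.relations ⊔ AddSubgroup.closure {d : KZ.FormalRep | ∃ ρ : ℂ → KZ.IntegralRep 3, (∀ z, IsAlgebraic ℚ z → 0 < z.im → (ρ z).domain = T z ∧ Set.EqOn (ρ z).integrand (fun p => 1 / p 2 ^ 3) (T z)) ∧ ∃ (k : ℕ) (z : Fin k → ℂ) (n : Fin k → ℤ), (∀ i, IsAlgebraic ℚ (z i)) ∧ (∀ i, 0 < (z i).im) ∧ ∑ i, (n i : ℝ) * (ρ (z i)).value = 0 ∧ d = ∑ i, n i • KZ.of (ρ (z i))}) := by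
  constructor
  · intro h T hT c hc
    exact ⟨1, one_ne_zero, by rw [one_smul]; exact h T hT c hc⟩
  · intro h T hT c hc
    obtain ⟨N, hN, hNc⟩ := h T hT c hc
    exact torsionFree_sup_closure_tetra T hT N hN c hNc

end Summit.KontsevichZagierPeriods.HyperbolicBloch.OffTetraSectorKernel

end
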